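import Mathlib
import Literature.MathematicalPhysics.QuantumFieldTheory.OSReconstructionNoE1Proofs
import Literature.MathematicalPhysics.QuantumFieldTheory.OSSectorContinuation
import Summits.QuantumFields.YangMills.Theorems.MirrorModularBoostsPlanarSpectralConeOneGapKernel
import Summits.QuantumFields.YangMills.Theorems.MirrorModularBoostsPlanarSpectralConeOneGapBounds
import Summits.QuantumFields.YangMills.Theorems.MirrorModularBoostsPlanarSpectralConeOneGapForm
import HarnessLib

/-!
# One-gap stretching: the Gram kernel is two-slot sector data; its holomorphic continuation

Crux `MirrorModularBoosts.PlanarSpectralCone` (stmt-QuantumFields-9664), line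
`positivity-disc-to-operator-cone`, stub `stub_oneGap` (density half), PART C: the engine step.

For a level-separated pair `P` (`k` points below `T ≥ 0`), `Q` (`l` points above `T`) of
time-ordered test functions, the Gram kernel of the stretched field vectors
`K(s,s') = 𝔖(Θ(P⊗Q_{se₀})* ⊗ (P⊗Q_{s'e₀})) = ⟪Ψ(s), Ψ(s')⟫` is two-slot sector data of opening
`π/2` in the sense of `LogSlot.IsSectorData` (OS II, Ch. V (5.4)): in the first slot, by the
re-centred pairing identity `K(s,s') = ⟪Ψ_{Q_{−T}}, e^{-sH} Ψ_{R(s')}⟫` (`OneGapKernel`), the slot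
function is the complex-time matrix element of `OneGapForm`, holomorphic on the right half-plane,
bounded by `2‖Ψ_{Q_{-T}}‖‖Ψ_{R(s')}‖` — polynomial in `s'` by temperedness (`OneGapBounds`) — and
continuous in `s'`; symmetrically in the second slot (self-adjointness of `e^{-sH}`). The tree engine
`IsSectorData.exists_extension` then continues `K` holomorphically to the sector region
`{Re w₀, Re w₁ > 0, |arg w₀| + |arg w₁| < π/2}` (`exists_sector_extension`).

References: Osterwalder–Schrader, CMP 42 (1975) Ch. V (5.4), (5.7)–(5.8). No definitions.
-/

noncomputable section

namespace Summit.QuantumFields.YangMills.Cruxes.PlanarSpectralCone.PositivityDiscToOperatorCone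

open MeasureTheory Complex Set Filter
open scoped InnerProductSpace SchwartzMap ComplexConjugate Topology
open Literature.MathematicalPhysics.QuantumLattice Literature.MathematicalPhysics.AQFT
  Literature.MathematicalPhysics.QuantumFieldTheory
open Literature.MathematicalPhysics.QuantumFieldTheory.LogSlot
  Literature.MathematicalPhysics.QuantumFieldTheory.OSEnvelope Literature.Analysis.Complex

namespace OneGap

/-! ### Small helpers -/

/-- Field vectors of equal test functions are equal (the time-ordering proofs are irrelevant). -/
theorem fieldVec_congr {ι : Type*} {d : ℕ} [NeZero d] {S : LabelledSchwingerFamily ι (EuclideanSpace ℝ (Fin d))}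
    (h : OSReconstructionNoE1 S) {n : ℕ} (k : Fin n → ι)
    {F G : 𝓢((Fin n → EuclideanSpace ℝ (Fin d)), ℂ)} (e : F = G) (hF : IsTimeOrdered F) (hG : IsTimeOrdered G) :
    h.fieldVec n k F hF = h.fieldVec n k G hG := by
  subst e; rfl

/-- `1 + x ≤ 2 (x + x⁻¹)` for `x > 0`. -/
theorem one_add_le_two_mul_add_inv {x : ℝ} (hx : 0 < x) : 1 + x ≤ 2 * (x + x⁻¹) := by
  have h1 : 1 ≤ x + x⁻¹ := OSEnvelope.one_le_add_inv hx
  have h2 : 0 < x⁻¹ := inv_pos.2 hx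
  linarith

/-- The growth factor of a positive real one-slot parameter. -/
theorem gFactor_fin_one {u : Fin 1 → ℝ} (hu : ∀ j, 0 < u j) :
    gFactor (fun j => ((u j : ℝ) : ℂ)) = u 0 + (u 0)⁻¹ := by
  simp [gFactor, Complex.norm_real, Real.norm_eq_abs, abs_of_pos (hu 0)]

/-- The growth factor of a positive real two-slot parameter. -/
theorem gFactor_fin_two {u : Fin 2 → ℝ} (hu : ∀ j, 0 < u j) :
    gFactor (fun j => ((u j : ℝ) : ℂ)) = (u 0 + (u 0)⁻¹) * (u 1 + (u 1)⁻¹) := by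
  simp [gFactor, Fin.prod_univ_two, Complex.norm_real, Real.norm_eq_abs, abs_of_pos (hu 0), abs_of_pos (hu 1)]

/-- A nonnegative real is at most one plus its square. -/
theorem le_one_add_sq (v : ℝ) : v ≤ 1 + v ^ 2 := by nlinarith [sq_nonneg (v - 1)]

/-! ### The sector extension of the Gram kernel -/

/-- **The Gram kernel of the one-gap stretching continues holomorphically to the two-slot sector
region of opening `π/2`.** For `T ≥ 0`, `P` time-ordered below `T`, `Q` time-ordered above `T`, there
is `G` holomorphic on `sectorRegion 1 (π/2)` with
`G(u₀, u₁) = 𝔖(Θ(P⊗Q_{u₀e₀})* ⊗ (P⊗Q_{u₁e₀}))` for all `u₀, u₁ > 0`. -/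
theorem exists_sector_extension (S : SchwingerFamily (EuclideanSpace ℝ (Fin 4)))
    (h : OSReconstructionNoE1 S.toLabelled) {k l : ℕ}
    {P : 𝓢((Fin k → EuclideanSpace ℝ (Fin 4)), ℂ)} {Q : 𝓢((Fin l → EuclideanSpace ℝ (Fin 4)), ℂ)} {T : ℝ}
    (hP : IsTimeOrdered P) (hQ : IsTimeOrdered Q)
    (hPT : tsupport (P : (Fin k → EuclideanSpace ℝ (Fin 4)) → ℂ) ⊆ {x | ∀ i, x i 0 < T})
    (hQT : tsupport (Q : (Fin l → EuclideanSpace ℝ (Fin 4)) → ℂ) ⊆ {x | ∀ i, T < x i 0})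
    (hT : 0 ≤ T) :
    ∃ G : (Fin 2 → ℂ) → ℂ, DifferentiableOn ℂ G (Literature.Analysis.Complex.sectorRegion 1 (Real.pi / 2)) ∧
      ∀ u : Fin 2 → ℝ, (∀ j, 0 < u j) → G (fun j => (u j : ℂ)) =
        S ((k + l) + (k + l))
          ((osAdjoint (P.appendTensor (translateMulti (SchwingerFamily.timeVec (u 0)) Q))).appendTensor
            (P.appendTensor (translateMulti (SchwingerFamily.timeVec (u 1)) Q))) := by
  -- the fixed vector `Ψ' = Ψ_{Q_{-T}}` and the re-centred vectors `V σ = Ψ_{R(σ⁺)}`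
  set Ψ' : h.Hilbert := h.fieldVec l (fun _ => ()) (translateMulti (SchwingerFamily.timeVec (-T)) Q)
    (isTimeOrdered_lower hQ hQT) with hΨ'
  have hRto : ∀ σ : ℝ, IsTimeOrdered (translateMulti (SchwingerFamily.timeVec T)
      ((osAdjoint P).appendTensor (P.appendTensor (translateMulti (SchwingerFamily.timeVec (max σ 0)) Q)))) :=
    fun σ => isTimeOrdered_recentre hP hQ hPT hQT hT (le_max_right σ 0)
  set V : ℝ → h.Hilbert := fun σ => h.fieldVec (k + (k + l)) (fun _ => ())
    (translateMulti (SchwingerFamily.timeVec T)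
      ((osAdjoint P).appendTensor (P.appendTensor (translateMulti (SchwingerFamily.timeVec (max σ 0)) Q))))
    (hRto σ) with hV
  have hFto : ∀ σ : ℝ, IsTimeOrdered (P.appendTensor (translateMulti (SchwingerFamily.timeVec (max σ 0)) Q)) :=
    fun σ => isTimeOrdered_stretch hP hQ hPT hQT (le_max_right σ 0)
  -- the slot functions
  choose φ0 hφ0d hφ0r hφ0b using fun σ : ℝ => exists_holo_inner_transfer h Ψ' (V σ)
  choose φ1 hφ1d hφ1r hφ1b using fun σ : ℝ => exists_holo_inner_transfer h (V σ) Ψ'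
  -- temperedness constants
  obtain ⟨CK, pK, hCK, hK⟩ := exists_norm_kernel_le S P Q
  obtain ⟨CR, pR, hCR, hR⟩ := exists_norm_recentre_sq_le S P Q T
  -- the norm of `V σ` grows polynomially
  have hVn : ∀ σ : ℝ, ‖V σ‖ ≤ (1 + CR) * (1 + |σ|) ^ pR := by
    intro σ
    have hsq : ‖V σ‖ ^ 2 ≤ CR * (1 + |σ|) ^ pR := by
      rw [hV, norm_fieldVec_sq]
      refine (Complex.re_le_norm _).trans ((hR (max σ 0)).trans ?_)
      have hm : |max σ 0| ≤ |σ| := by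
        rw [abs_of_nonneg (le_max_right σ 0)]
        exact max_le (le_abs_self σ) (abs_nonneg σ)
      exact mul_le_mul_of_nonneg_left (pow_le_pow_left₀ (by positivity) (by linarith) pR) hCR
    have h1 : (1 : ℝ) ≤ (1 + |σ|) ^ pR := one_le_pow₀ (by linarith [abs_nonneg σ])
    calc ‖V σ‖ ≤ 1 + ‖V σ‖ ^ 2 := le_one_add_sq _
      _ ≤ 1 + CR * (1 + |σ|) ^ pR := by linarith
      _ ≤ (1 + CR) * (1 + |σ|) ^ pR := by nlinarith
  -- `V` is continuous
  have hVc : Continuous V := by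
    have hRc : Continuous fun σ : ℝ => translateMulti (SchwingerFamily.timeVec T)
        ((osAdjoint P).appendTensor (P.appendTensor (translateMulti (SchwingerFamily.timeVec (max σ 0)) Q))) := by
      have h1 : Continuous fun σ : ℝ => P.appendTensor (translateMulti (SchwingerFamily.timeVec (max σ 0)) Q) :=
        (continuous_stretch P Q).comp (continuous_id.max continuous_const)
      exact (translateMulti (SchwingerFamily.timeVec (d := 4) T)).continuous.comp
        (continuous_appendTensor.comp (continuous_const.prodMk h1))
    exact continuous_iff_continuousAt.2 fun σ₀ =>
      tendsto_fieldVec h (fun _ => ()) hRto (hRto σ₀) (hRc.tendsto σ₀)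
  -- continuity of the slot functions in the real parameter
  have hc0 : ∀ τ : ℂ, 0 < τ.re → Continuous fun σ : ℝ => φ0 σ τ := by
    intro τ hτ
    refine continuous_iff_continuousAt.2 fun σ₀ => ?_
    rw [ContinuousAt, tendsto_iff_norm_sub_tendsto_zero]
    refine squeeze_zero (fun σ => norm_nonneg _) (fun σ => norm_holo_inner_transfer_sub_right_le h Ψ'
      (V σ) (V σ₀) (hφ0d σ) (hφ0d σ₀) (hφ0r σ) (hφ0r σ₀) hτ) ?_
    have h1 : Tendsto (fun σ => V σ - V σ₀) (𝓝 σ₀) (𝓝 0) := by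
      simpa using (hVc.tendsto σ₀).sub_const (V σ₀)
    simpa using (tendsto_const_nhds (x := 2 * ‖Ψ'‖)).mul h1.norm
  have hc1 : ∀ τ : ℂ, 0 < τ.re → Continuous fun σ : ℝ => φ1 σ τ := by
    intro τ hτ
    refine continuous_iff_continuousAt.2 fun σ₀ => ?_
    rw [ContinuousAt, tendsto_iff_norm_sub_tendsto_zero]
    refine squeeze_zero (fun σ => norm_nonneg _) (fun σ => norm_holo_inner_transfer_sub_left_le h
      (V σ) (V σ₀) Ψ' (hφ1d σ) (hφ1d σ₀) (hφ1r σ) (hφ1r σ₀) hτ) ?_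
    have h1 : Tendsto (fun σ => V σ - V σ₀) (𝓝 σ₀) (𝓝 0) := by
      simpa using (hVc.tendsto σ₀).sub_const (V σ₀)
    simpa using (h1.norm.const_mul 2).mul (tendsto_const_nhds (x := ‖Ψ'‖))
  -- the kernel at nonnegative real points is the inner product of the stretched field vectors
  have hKreal : ∀ a b : ℝ, ∀ (ha : 0 ≤ a) (hb : 0 ≤ b),
      S ((k + l) + (k + l))
        ((osAdjoint (P.appendTensor (translateMulti (SchwingerFamily.timeVec a) Q))).appendTensor
          (P.appendTensor (translateMulti (SchwingerFamily.timeVec b) Q))) =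
      ⟪h.fieldVec (k + l) (fun _ => ()) _ (isTimeOrdered_stretch hP hQ hPT hQT ha),
        h.fieldVec (k + l) (fun _ => ()) _ (isTimeOrdered_stretch hP hQ hPT hQT hb)⟫_ℂ := by
    intro a b ha hb
    rw [inner_fieldVec_fieldVec']
    rfl
  -- the slot functions at real points: the re-centred pairing identity
  have hreal0 : ∀ (σ : ℝ) (hσ : 0 < σ) (x : ℝ) (hx : 0 < x), φ0 σ x =
      S ((k + l) + (k + l))
        ((osAdjoint (P.appendTensor (translateMulti (SchwingerFamily.timeVec x) Q))).appendTensor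
          (P.appendTensor (translateMulti (SchwingerFamily.timeVec σ) Q))) := by
    intro σ hσ x hx
    rw [hφ0r σ x hx, hKreal x σ hx.le hσ.le, inner_stretch_eq S h P Q T hx.le _ _ (isTimeOrdered_lower hQ hQT)
      (isTimeOrdered_recentre hP hQ hPT hQT hT hσ.le), hV]
    congr 2
    exact fieldVec_congr h _ (by rw [max_eq_left hσ.le]) _ _
  have hreal1 : ∀ (σ : ℝ) (hσ : 0 < σ) (x : ℝ) (hx : 0 < x), φ1 σ x =
      S ((k + l) + (k + l))
        ((osAdjoint (P.appendTensor (translateMulti (SchwingerFamily.timeVec σ) Q))).appendTensor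
          (P.appendTensor (translateMulti (SchwingerFamily.timeVec x) Q))) := by
    intro σ hσ x hx
    rw [hφ1r σ x hx, ← h.inner_transfer_left, ← inner_conj_symm, hKreal σ x hσ.le hx.le,
      ← inner_conj_symm (h.fieldVec (k + l) _ _ _), inner_stretch_eq S h P Q T hx.le _ _ (isTimeOrdered_lower hQ hQT)
      (isTimeOrdered_recentre hP hQ hPT hQT hT hσ.le), hV]
    congr 3
    exact fieldVec_congr h _ (by rw [max_eq_left hσ.le]) _ _
  -- the data
  set Kfun : (Fin 2 → ℝ) → ℂ := fun u =>
    S ((k + l) + (k + l))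
      ((osAdjoint (P.appendTensor (translateMulti (SchwingerFamily.timeVec (u 0)) Q))).appendTensor
        (P.appendTensor (translateMulti (SchwingerFamily.timeVec (u 1)) Q))) with hKfun
  set E : Fin 2 → (Fin 1 → ℝ) → ℂ → ℂ := ![fun u' τ => φ0 (u' 0) τ, fun u' τ => φ1 (u' 0) τ] with hE
  have hnQ : 0 ≤ ‖Ψ'‖ := norm_nonneg _
  have hdata : IsSectorData (Real.pi / 2) Kfun E (CK * 4 ^ pK) (pK + pR)
      (fun _ => 2 * ‖Ψ'‖ * (1 + CR) * 2 ^ pR) := by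
    refine ⟨?_, by positivity, ?_, ?_, ?_, fun _ => by positivity, ?_, ?_⟩
    · -- continuity of the kernel on the open quadrant
      exact ((S ((k + l) + (k + l))).continuous.comp (continuous_kernelTest P Q)).continuousOn
    · -- polynomial bound of the kernel
      intro u hu
      have hne : ∀ j, ((u j : ℝ) : ℂ) ≠ 0 := fun j => by exact_mod_cast (hu j).ne'
      have hg1 : 1 ≤ gFactor (fun j => ((u j : ℝ) : ℂ)) := one_le_gFactor hne
      have hprod : (1 + |u 0|) * (1 + |u 1|) ≤ 4 * gFactor (fun j => ((u j : ℝ) : ℂ)) := by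
        rw [gFactor_fin_two hu, abs_of_pos (hu 0), abs_of_pos (hu 1)]
        have h0 := one_add_le_two_mul_add_inv (hu 0)
        have h1 := one_add_le_two_mul_add_inv (hu 1)
        have h0' : (0 : ℝ) ≤ 1 + u 0 := by linarith [hu 0]
        have h1' : (0 : ℝ) ≤ u 1 + (u 1)⁻¹ := by have := inv_pos.2 (hu 1); linarith [hu 1]
        calc (1 + u 0) * (1 + u 1) ≤ (2 * (u 0 + (u 0)⁻¹)) * (2 * (u 1 + (u 1)⁻¹)) :=
              mul_le_mul h0 h1 (by linarith [hu 1]) (by linarith)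
          _ = 4 * ((u 0 + (u 0)⁻¹) * (u 1 + (u 1)⁻¹)) := by ring
      calc ‖Kfun u‖ ≤ CK * ((1 + |u 0|) * (1 + |u 1|)) ^ pK := hK (u 0) (u 1)
        _ ≤ CK * (4 * gFactor (fun j => ((u j : ℝ) : ℂ))) ^ pK :=
            mul_le_mul_of_nonneg_left (pow_le_pow_left₀ (by positivity) hprod pK) hCK
        _ = CK * 4 ^ pK * gFactor (fun j => ((u j : ℝ) : ℂ)) ^ pK := by rw [mul_pow]; ring
        _ ≤ CK * 4 ^ pK * gFactor (fun j => ((u j : ℝ) : ℂ)) ^ (pK + pR) :=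
            mul_le_mul_of_nonneg_left (gFactor_pow_le_pow hne (Nat.le_add_right _ _)) (by positivity)
    · -- continuity of the slots in the real parameter
      intro i τ hτ
      fin_cases i
      · simp only [hE, Fin.zero_eta, Fin.isValue, Matrix.cons_val_zero]
        exact ((hc0 τ hτ.1).comp (continuous_apply 0)).continuousOn
      · simp only [hE, Fin.mk_one, Fin.isValue, Matrix.cons_val_one, Matrix.cons_val_fin_one]
        exact ((hc1 τ hτ.1).comp (continuous_apply 0)).continuousOn
    · -- holomorphy of the slots
      intro i u' hu'
      fin_cases i
      · simpa [hE] using (hφ0d (u' 0)).mono fun τ hτ => hτ.1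
      · simpa [hE] using (hφ1d (u' 0)).mono fun τ hτ => hτ.1
    · -- the slot bounds
      intro i c _ u' τ hu' hτ _
      have hne : ∀ j, ((u' j : ℝ) : ℂ) ≠ 0 := fun j => by exact_mod_cast (hu' j).ne'
      have hg1 : 1 ≤ gFactor (fun j => ((u' j : ℝ) : ℂ)) := one_le_gFactor hne
      have hτ1 : (1 : ℝ) ≤ ‖τ‖ + ‖τ‖⁻¹ := OSEnvelope.one_le_add_inv (norm_pos_iff.2 fun h0 => by
        rw [h0] at hτ; simp at hτ)
      have hgrow : (1 + |u' 0|) ^ pR ≤ 2 ^ pR * gFactor (fun j => ((u' j : ℝ) : ℂ)) ^ (pK + pR) := by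
        have h1 : 1 + |u' 0| ≤ 2 * gFactor (fun j => ((u' j : ℝ) : ℂ)) := by
          rw [gFactor_fin_one hu', abs_of_pos (hu' 0)]
          exact one_add_le_two_mul_add_inv (hu' 0)
        calc (1 + |u' 0|) ^ pR ≤ (2 * gFactor (fun j => ((u' j : ℝ) : ℂ))) ^ pR :=
              pow_le_pow_left₀ (by positivity) h1 pR
          _ = 2 ^ pR * gFactor (fun j => ((u' j : ℝ) : ℂ)) ^ pR := mul_pow _ _ _
          _ ≤ 2 ^ pR * gFactor (fun j => ((u' j : ℝ) : ℂ)) ^ (pK + pR) :=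
              mul_le_mul_of_nonneg_left (gFactor_pow_le_pow hne (Nat.le_add_left _ _)) (by positivity)
      have hVσ := hVn (u' 0)
      have key : 2 * ‖Ψ'‖ * ‖V (u' 0)‖ ≤
          2 * ‖Ψ'‖ * (1 + CR) * 2 ^ pR * gFactor (fun j => ((u' j : ℝ) : ℂ)) ^ (pK + pR) *
            (‖τ‖ + ‖τ‖⁻¹) ^ (pK + pR) := by
        have h2 : (1 : ℝ) ≤ (‖τ‖ + ‖τ‖⁻¹) ^ (pK + pR) := one_le_pow₀ hτ1
        calc 2 * ‖Ψ'‖ * ‖V (u' 0)‖ ≤ 2 * ‖Ψ'‖ * ((1 + CR) * (1 + |u' 0|) ^ pR) :=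
              mul_le_mul_of_nonneg_left hVσ (by positivity)
          _ ≤ 2 * ‖Ψ'‖ * ((1 + CR) * (2 ^ pR * gFactor (fun j => ((u' j : ℝ) : ℂ)) ^ (pK + pR))) := by
              gcongr
          _ = 2 * ‖Ψ'‖ * (1 + CR) * 2 ^ pR * gFactor (fun j => ((u' j : ℝ) : ℂ)) ^ (pK + pR) * 1 := by ring
          _ ≤ 2 * ‖Ψ'‖ * (1 + CR) * 2 ^ pR * gFactor (fun j => ((u' j : ℝ) : ℂ)) ^ (pK + pR) *
              (‖τ‖ + ‖τ‖⁻¹) ^ (pK + pR) := by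
              exact mul_le_mul_of_nonneg_left h2 (by positivity)
      fin_cases i
      · simp only [hE, Fin.zero_eta, Fin.isValue, Matrix.cons_val_zero]
        exact (norm_holo_inner_transfer_le h Ψ' (V (u' 0)) (hφ0d (u' 0)) (hφ0r (u' 0)) hτ).trans key
      · simp only [hE, Fin.mk_one, Fin.isValue, Matrix.cons_val_one, Matrix.cons_val_fin_one]
        refine (norm_holo_inner_transfer_le h (V (u' 0)) Ψ' (hφ1d (u' 0)) (hφ1r (u' 0)) hτ).trans ?_
        rw [show 2 * ‖V (u' 0)‖ * ‖Ψ'‖ = 2 * ‖Ψ'‖ * ‖V (u' 0)‖ by ring]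
        exact key
    · -- the slots at real points
      intro i u' hu' x hx
      fin_cases i
      · simp only [hE, Fin.zero_eta, Fin.isValue, Matrix.cons_val_zero]
        rw [hreal0 (u' 0) (hu' 0) x hx, hKfun]
        simp [Fin.insertNth_zero']
      · simp only [hE, Fin.mk_one, Fin.isValue, Matrix.cons_val_one, Matrix.cons_val_fin_one]
        rw [hreal1 (u' 0) (hu' 0) x hx, hKfun]
        have h0 : (1 : Fin 2).succAbove (0 : Fin 1) = 0 := by decide
        have h0' : Fin.insertNth (α := fun _ : Fin 2 => ℝ) (1 : Fin 2) x u' 0 = u' 0 := by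
          conv_lhs => rw [← h0]
          rw [Fin.insertNth_apply_succAbove]
        have h1' : Fin.insertNth (α := fun _ : Fin 2 => ℝ) (1 : Fin 2) x u' 1 = x := by
          simp
        simp only [h0', h1']
  obtain ⟨G, hGd, hGr⟩ := hdata.exists_extension (by positivity) le_rfl
  exact ⟨G, hGd, fun u hu => by rw [hGr u hu]⟩

end OneGap

end Summit.QuantumFields.YangMills.Cruxes.PlanarSpectralCone.PositivityDiscToOperatorCone
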